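import Literature.AlgebraicGeometry.Motives.HodgeStructureCentralizerSemisimplePoints
import HarnessLib

/-!
# THE CENTRE OF MILNE'S GROUP `S(A)`: `Z(S(A)(K)) = S(A)(K) ∩ (C₀(A) ⊗ K)` — an element of the Lefschetz group is central iff it
# lies in `End⁰(A) ⊗ K`, i.e. iff it is a `†`-unitary element of the CENTRE `C₀ ⊗ K` of `End⁰(A) ⊗ K` (Milne's `S₀`); on
# `ℚ`-points `Z(S(H)(ℚ)) = S(H)(ℚ) ∩ Z(E_φ)^×`; for `E_φ = ℚ` the centre is `{±1}` (Milne 1999 §1 pp. 643–645, §4 p. 659)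

[topic AlgebraicGeometry/Motives]

Layer `Literature/AlgebraicGeometry/Motives`, lane `lit-hodgefound` (Track 2 foundations library; prover seat
`lit-hodgefound-p02`, generation 54, self-proposed row g54-#4). THEOREMS ONLY: no definition, no named fact (net debt `0`),
no instance, no notation.  Fourth file of the theme «`(C(A), †)` is a semisimple `k`-algebra with involution and `S(A)` is its
unitary group» (g54-#1 `Motives/HodgeStructureCentralizerSemisimple`, g54-#2 `…SemisimplePoints`, g54-#3 `…SimpleFactors`).  Milne:
`S(A)(R) = {γ ∈ C(A) ⊗_k R | γ†γ = 1}` (p. 644), and (p. 645, over `𝔽`) `S₀(A)(R) = {γ ∈ C₀(A) ⊗_ℚ R | γ†γ = 1}` with `C₀(A)`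
the CENTRE of `End⁰(A)`.  Here, for every polarized `ℚ`-Hodge structure `(H, ψ)` on a finite-dimensional `V` and every field
`K ⊇ ℚ`: an element `γ` of the tree's `S(H)(K) = ψ.lefschetzGroupBaseChange K ≤ GL_K(K ⊗ V)` (`Motives/HodgeStructureLefschetzGroupPoints`)
is CENTRAL in `S(H)(K)` iff `γ ∈ E_φ ⊗ K = K[a_K | a ∈ E_φ]`, iff `γ` is central in the ALGEBRA `C(H)(K)`, iff
`γ ∈ C₀ ⊗ K = span_K {z_K | z ∈ Z(E_φ)}` — because `C(H)(K)` is generated by `S(H)(K)` as a `K`-algebra (the tree's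
`Polarization.adjoin_coe_lefschetzGroupBaseChange_eq_centralizer_endAlg_baseChange`, `Motives/HodgeStructureCentralizerGeneratedByLefschetzGroup`)
and the commutant of `C(H)(K)` is `E_φ ⊗ K` (Remark 1.2 on `K`-points, g54-#2).  So `Z(S(A)(K)) = S(A)(K) ∩ S₀`-type: the
`†`-unitary elements of the commutative algebra `C₀ ⊗ K`.  On `ℚ`-points (`S(H)(ℚ) = ψ.lefschetzGroup ≤ GL(V)`, generated picture
via `ℚ[Hg(H)(ℚ)] = C(H)`, the tree's `adjoin_hodgeGroup_eq_centralizer_endAlg`): `γ ∈ S(H)(ℚ)` is central iff `γ` is a Hodge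
endomorphism, iff `γ ∈ Z(E_φ)`; consequently `S(H)(ℚ)` is commutative iff `S(H)(ℚ) ⊆ E_φ`, and for `E_φ = ℚ` (Milne's type I with
`F = ℚ`, `S(A) = Sp`) the centre of `S(H)(ℚ)` is `{±1}`.

## The sources, verbatim

* J. S. Milne, *Lefschetz classes on abelian varieties*, Duke Math. J. 96 (1999) 639–675 [Milne1999LefschetzClasses] (held
  `paper:doi-10-1215-s0012-7094-99-09620-5`, folios 5–7, 21): p. 643 **Remark 1.2** "the centralizer of `C(A)` in `End_k(V(A))`
  is `End⁰(A) ⊗_ℚ k`"; p. 644 L16–L24 "`S(A)(R) = {γ ∈ C(A) ⊗_k R | γ†γ = 1}`. Thus, for any ample divisor `D` on `A`, `S(A)` is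
  the largest algebraic subgroup of `Sp(e_D)` whose elements commute with the endomorphisms of `A`. […] It is a reductive group
  (not necessarily connected)"; p. 645 L1–L6 "let `C₀(A)` be the centre of the `ℚ`-algebra `End⁰(A)` — it is a product of fields
  […] Define `S₀(A)` to be the algebraic group over `ℚ` such that, for all commutative `ℚ`-algebras `R`,
  `S₀(A)(R) = {γ ∈ C₀(A) ⊗_ℚ R | γ†γ = 1}`."; §4 p. 659 L31–L34 "the homomorphism `a ↦ (a⁻¹, a⁻²) : 𝔾_m → GL(V(A)) × 𝔾_m` takes
  values in `L(A)`" (the scalars; on `S(A) = L(A) ∩ (GL × {1})` only `a = ±1` survive); §3 p. 653 "the `k`-algebra `C(A)` is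
  generated by the `γ ∈ S(A)(k)`" (the tree's `adjoin_coe_lefschetzGroupBaseChange_eq_centralizer_endAlg_baseChange`).
* H. Lange, *Abelian Varieties over the Complex Numbers* (2023) [Lange2023AbelianVarietiesComplex], §7.2.4 Exercise (4)
  (`Lf(X) = {g ∈ Sp(W, E) | g φ = φ g ∀ φ ∈ End_ℚ(X)}⁰`, contains `Hg(X)`).

## Dictionary and what is proved (namespace `Literature.AlgebraicGeometry.Motives.HodgeStructure`)

`S(H)(K) = ψ.lefschetzGroupBaseChange K`, `S(H)(ℚ) = ψ.lefschetzGroup`, `C(H)(K)`, `E_φ ⊗ K = Algebra.adjoin K {a_K}`,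
`C₀ = E_φ ⊓ C(H) = Z(E_φ)` pushed into `End_ℚ(V)` (as in g54-#1/#2); `Subgroup.center` is Mathlib's centre of a group.

* §1 `K`-points: **`Polarization.mem_center_lefschetzGroupBaseChange_iff`** (`γ` central in `S(H)(K)` iff `↑γ ∈ E_φ ⊗ K`),
  `Polarization.mem_center_lefschetzGroupBaseChange_iff_mem_span` (iff `↑γ ∈ span_K {a_K}`),
  **`Polarization.mem_center_lefschetzGroupBaseChange_iff_mem_center_centralizer`** (`Z(S(H)(K)) = S(H)(K) ∩ Z(C(H)(K))`),
  **`Polarization.mem_center_lefschetzGroupBaseChange_iff_mem_span_center`** (`Z(S(H)(K)) = S(H)(K) ∩ (C₀ ⊗ K)`: iff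
  `↑γ ∈ span_K {z_K | z ∈ E_φ ∩ C(H)}` — Milne's `S₀`), `Polarization.baseChange_mem_center_lefschetzGroupBaseChange` (`z_K` is
  central for `z ∈ S(H)(ℚ) ∩ E_φ`).
* §2 `ℚ`-points: **`Polarization.mem_center_lefschetzGroup_iff`** (`γ` central in `S(H)(ℚ)` iff `↑γ ∈ E_φ`),
  `Polarization.mem_center_lefschetzGroup_iff_exists_mem_center` (iff `↑γ = ↑z` for some `z ∈ Z(E_φ)`),
  `Polarization.center_lefschetzGroup_eq_top_iff` (`S(H)(ℚ)` commutative iff `S(H)(ℚ) ⊆ E_φ`),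
  **`Polarization.mem_center_lefschetzGroup_iff_of_endAlg_eq_bot`** (`E_φ = ℚ`, `V ≠ 0`: central iff `↑γ = ±1`).
-/

noncomputable section

open scoped TensorProduct

namespace Literature.AlgebraicGeometry.Motives

namespace HodgeStructure

universe u uK

variable (K : Type uK) [Field K] [Algebra ℚ K] {V : Type u} [AddCommGroup V] [Module ℚ V] [Module.Finite ℚ V] {n : ℤ}
  {H : HodgeStructure V n}

/-- The commutant of a set is the commutant of the algebra it generates. [folklore] -/
private theorem centralizer_coe_adjoin_eq₅₄' {R : Type*} {A : Type*} [CommSemiring R] [Semiring A] [Algebra R A]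
    (s : Set A) : Subalgebra.centralizer R (Algebra.adjoin R s : Set A) = Subalgebra.centralizer R s := by
  refine le_antisymm (fun z hz => ?_) (fun z hz => ?_)
  · rw [Subalgebra.mem_centralizer_iff] at hz ⊢
    exact fun g hg => hz g (Algebra.subset_adjoin hg)
  · rw [Subalgebra.mem_centralizer_iff] at hz ⊢
    intro g hg
    have hle : Algebra.adjoin R s ≤ Subalgebra.centralizer R {z} := Algebra.adjoin_le fun x hx => by
      rw [SetLike.mem_coe, Subalgebra.mem_centralizer_iff]
      intro y hy
      rw [Set.mem_singleton_iff.1 hy]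
      exact (hz x hx).symm
    exact ((Subalgebra.mem_centralizer_iff R).1 (hle hg) z rfl).symm

omit [Module.Finite ℚ V] in
/-- `γ ∈ S(H)(K) ⟹ ↑γ ∈ C(H)(K)` («`γ ∈ C(A) ⊗_k R`»). [cite: Milne1999LefschetzClasses, §1 p. 644 L16–L18] -/
private theorem Polarization.coe_mem_centralizer_endAlg_baseChange_of_mem₅₄ (ψ : Polarization H)
    {γ : (K ⊗[ℚ] V) ≃ₗ[K] (K ⊗[ℚ] V)} (hγ : γ ∈ ψ.lefschetzGroupBaseChange K) :
    (γ : Module.End K (K ⊗[ℚ] V)) ∈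
      Subalgebra.centralizer K ((fun a : Module.End ℚ V => a.baseChange K) '' (H.endAlg : Set (Module.End ℚ V))) := by
  rw [Subalgebra.mem_centralizer_iff]
  rintro _ ⟨a, ha, rfl⟩
  exact LinearMap.ext fun x => ((ψ.mem_lefschetzGroupBaseChange_iff γ).1 hγ).1 ⟨a, ha⟩ x

/-! ## §1 `K`-points: `Z(S(H)(K)) = S(H)(K) ∩ (E_φ ⊗ K) = S(H)(K) ∩ Z(C(H)(K)) = S(H)(K) ∩ (C₀ ⊗ K)` -/

/-- **AN ELEMENT OF `S(A)(K)` IS CENTRAL IFF IT LIES IN `End⁰(A) ⊗ K`**: for a polarized `ℚ`-Hodge structure and a field `K ⊇ ℚ`,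
`γ ∈ S(H)(K)` commutes with all of `S(H)(K)` iff `↑γ ∈ E_φ ⊗ K = K[a_K | a ∈ E_φ]` — `⟹`: `S(H)(K)` generates `C(H)(K)` as a
`K`-algebra («the `k`-algebra `C(A)` is generated by the `γ ∈ S(A)(k)`», the tree's
`adjoin_coe_lefschetzGroupBaseChange_eq_centralizer_endAlg_baseChange`), so `γ` commutes with `C(H)(K)`, whose commutant is
`E_φ ⊗ K` (Remark 1.2 on `K`-points, g54-#2); `⟸`: `S(H)(K) ⊆ C(H)(K)` commutes with `E_φ ⊗ K`.
[cite: Milne1999LefschetzClasses, §1 Remark 1.2 (p. 643), p. 644 L16–L24 and §3 p. 653] [cite: Lange2023AbelianVarietiesComplex, §7.2.4 Exercise (4)] -/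
theorem Polarization.mem_center_lefschetzGroupBaseChange_iff (ψ : Polarization H) (γ : ψ.lefschetzGroupBaseChange K) :
    γ ∈ Subgroup.center (ψ.lefschetzGroupBaseChange K) ↔
      ((γ : (K ⊗[ℚ] V) ≃ₗ[K] (K ⊗[ℚ] V)) : Module.End K (K ⊗[ℚ] V)) ∈
        Algebra.adjoin K (Set.range fun a : H.endAlg => (a : Module.End ℚ V).baseChange K) := by
  rw [Subgroup.mem_center_iff, ← centralizer_centralizer_endAlg_baseChange_eq_adjoin K H ⟨ψ⟩,
    ← ψ.adjoin_coe_lefschetzGroupBaseChange_eq_centralizer_endAlg_baseChange K, centralizer_coe_adjoin_eq₅₄',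
    Subalgebra.mem_centralizer_iff]
  constructor
  · rintro h _ ⟨δ, hδ, rfl⟩
    have hδγ := congrArg (fun ε : ψ.lefschetzGroupBaseChange K => ((ε : (K ⊗[ℚ] V) ≃ₗ[K] (K ⊗[ℚ] V)) :
      Module.End K (K ⊗[ℚ] V))) (h ⟨δ, hδ⟩)
    simpa only [Subgroup.coe_mul, LinearEquiv.coe_toLinearMap_mul] using hδγ
  · intro h δ
    refine Subtype.ext (LinearEquiv.toLinearMap_injective ?_)
    rw [Subgroup.coe_mul, Subgroup.coe_mul, LinearEquiv.coe_toLinearMap_mul, LinearEquiv.coe_toLinearMap_mul]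
    exact h _ ⟨δ, δ.2, rfl⟩

/-- The same with `E_φ ⊗ K` in its span spelling: `γ` is central in `S(H)(K)` iff `↑γ ∈ span_K {a_K | a ∈ E_φ}`.
[cite: Milne1999LefschetzClasses, §1 Remark 1.2 (p. 643) and p. 644 L16–L24] -/
theorem Polarization.mem_center_lefschetzGroupBaseChange_iff_mem_span (ψ : Polarization H)
    (γ : ψ.lefschetzGroupBaseChange K) :
    γ ∈ Subgroup.center (ψ.lefschetzGroupBaseChange K) ↔
      ((γ : (K ⊗[ℚ] V) ≃ₗ[K] (K ⊗[ℚ] V)) : Module.End K (K ⊗[ℚ] V)) ∈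
        Submodule.span K (Set.range fun a : H.endAlg => (a : Module.End ℚ V).baseChange K) := by
  rw [ψ.mem_center_lefschetzGroupBaseChange_iff K γ, mem_adjoin_baseChange_endAlg_iff_mem_span' K H ⟨ψ⟩]

/-- **`Z(S(H)(K)) = S(H)(K) ∩ Z(C(H)(K))`**: `γ ∈ S(H)(K)` is central in the GROUP `S(H)(K)` iff `↑γ` is central in the ALGEBRA
`C(H)(K)` (both say `↑γ ∈ (E_φ ⊗ K) ∩ C(H)(K)`, g54-#2 `mem_center_centralizer_endAlg_baseChange_iff`) — the unitary group of the
semisimple algebra with involution `(C(A) ⊗ K, †)` has centre `U ∩ Z(C(A) ⊗ K)`. [cite: Milne1999LefschetzClasses, §1 p. 644 L16–L24 and Remark 1.2]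
[cite: Zarhin2018SuperellipticJacobians, §4 Thm. 4.1 (arXiv p. 10)] -/
theorem Polarization.mem_center_lefschetzGroupBaseChange_iff_mem_center_centralizer (ψ : Polarization H)
    (γ : ψ.lefschetzGroupBaseChange K) :
    γ ∈ Subgroup.center (ψ.lefschetzGroupBaseChange K) ↔
      (⟨((γ : (K ⊗[ℚ] V) ≃ₗ[K] (K ⊗[ℚ] V)) : Module.End K (K ⊗[ℚ] V)),
          ψ.coe_mem_centralizer_endAlg_baseChange_of_mem₅₄ K γ.2⟩ :
          Subalgebra.centralizer K ((fun a : Module.End ℚ V => a.baseChange K) '' (H.endAlg : Set (Module.End ℚ V)))) ∈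
        Subalgebra.center K (Subalgebra.centralizer K
          ((fun a : Module.End ℚ V => a.baseChange K) '' (H.endAlg : Set (Module.End ℚ V)))) := by
  rw [ψ.mem_center_lefschetzGroupBaseChange_iff K γ, mem_center_centralizer_endAlg_baseChange_iff K H ⟨ψ⟩]

/-- **`Z(S(A)(K)) = S(A)(K) ∩ (C₀(A) ⊗ K)` — MILNE'S `S₀`**: `γ ∈ S(H)(K)` is central iff `↑γ` is a `K`-linear combination of the
`z_K`, `z ∈ C₀ = E_φ ∩ C(H) = Z(E_φ)` — i.e. iff `γ` is a (`†`-unitary, as every element of `S`) element of the base-changed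
CENTRE of the endomorphism algebra (g54-#2 «`Z(C'(A)) = C₀(A) ⊗ k'`»). [cite: Milne1999LefschetzClasses, §1 p. 644 L16–L24 and p. 645 L1–L6 (`C₀`, `S₀`)]
[cite: Deligne1982HodgeCycles, I §3 Prop. 3.1 (proof: extension of scalars)] -/
theorem Polarization.mem_center_lefschetzGroupBaseChange_iff_mem_span_center (ψ : Polarization H)
    (γ : ψ.lefschetzGroupBaseChange K) :
    γ ∈ Subgroup.center (ψ.lefschetzGroupBaseChange K) ↔
      ((γ : (K ⊗[ℚ] V) ≃ₗ[K] (K ⊗[ℚ] V)) : Module.End K (K ⊗[ℚ] V)) ∈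
        Submodule.span K ((fun z : Module.End ℚ V => z.baseChange K) ''
          ((H.endAlg ⊓ Subalgebra.centralizer ℚ (H.endAlg : Set (Module.End ℚ V)) :
            Subalgebra ℚ (Module.End ℚ V)) : Set (Module.End ℚ V))) := by
  rw [ψ.mem_center_lefschetzGroupBaseChange_iff_mem_center_centralizer K γ,
    ← toSubmodule_map_val_center_centralizer_endAlg_baseChange_eq_span K H ⟨ψ⟩, Subalgebra.mem_toSubmodule,
    Subalgebra.mem_map]
  constructor
  · intro h
    exact ⟨_, h, rfl⟩
  · rintro ⟨z, hz, hzγ⟩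
    have hz' : z = ⟨((γ : (K ⊗[ℚ] V) ≃ₗ[K] (K ⊗[ℚ] V)) : Module.End K (K ⊗[ℚ] V)),
        ψ.coe_mem_centralizer_endAlg_baseChange_of_mem₅₄ K γ.2⟩ := Subtype.ext hzγ
    rwa [hz'] at hz

/-- **The base change `z_K` of a rational point `z ∈ S(H)(ℚ)` (as an element of `S(H)(K)`) lying in `E_φ` is central in `S(H)(K)`**
(`z_K ∈ E_φ ⊗ K`). [cite: Milne1999LefschetzClasses, §1 p. 644 L16–L24 and Remark 1.6 (p. 644)] -/
theorem Polarization.baseChange_mem_center_lefschetzGroupBaseChange (ψ : Polarization H)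
    {γ : ψ.lefschetzGroupBaseChange K} {z : Module.End ℚ V} (hz : z ∈ H.endAlg)
    (hγz : ((γ : (K ⊗[ℚ] V) ≃ₗ[K] (K ⊗[ℚ] V)) : Module.End K (K ⊗[ℚ] V)) = z.baseChange K) :
    γ ∈ Subgroup.center (ψ.lefschetzGroupBaseChange K) := by
  rw [ψ.mem_center_lefschetzGroupBaseChange_iff K γ, hγz]
  exact Algebra.subset_adjoin ⟨⟨z, hz⟩, rfl⟩

/-! ## §2 `ℚ`-points: `Z(S(H)(ℚ)) = S(H)(ℚ) ∩ E_φ = S(H)(ℚ) ∩ Z(E_φ)` -/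

/-- **A RATIONAL POINT OF `S(A)` IS CENTRAL IFF IT IS AN ENDOMORPHISM OF `A`**: `γ ∈ S(H)(ℚ)` commutes with all of `S(H)(ℚ)` iff
`↑γ ∈ E_φ` — `⟹`: `γ` commutes with `Hg(H)(ℚ) ≤ S(H)(ℚ)` (the tree's `hodgeGroup_le_lefschetzGroup`), hence with
`ℚ[Hg(H)(ℚ)] = C(H)` (the tree's `adjoin_hodgeGroup_eq_centralizer_endAlg`), so `↑γ ∈ Z_{End_ℚ(V)}(C(H)) = E_φ` (Remark 1.2,
g54-#1); `⟸`: `S(H)(ℚ) ⊆ C(H)` commutes with `E_φ`. [cite: Milne1999LefschetzClasses, §1 Remark 1.2 (p. 643), p. 644 L16–L24 and §4 p. 660 (`L(A) ⊃ Hg(A)`)]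
[cite: Deligne1982HodgeCycles, I §5 Prop. 5.1 (proof: `E` is the commutant of `G`)] -/
theorem Polarization.mem_center_lefschetzGroup_iff (ψ : Polarization H) (γ : ψ.lefschetzGroup) :
    γ ∈ Subgroup.center ψ.lefschetzGroup ↔ ((γ : V ≃ₗ[ℚ] V) : Module.End ℚ V) ∈ H.endAlg := by
  haveI : HodgeTensorFacts.{u, u} := hodgeTensorFacts_holds
  rw [Subgroup.mem_center_iff, ← centralizer_centralizer_endAlg_eq' H ⟨ψ⟩, ← adjoin_hodgeGroup_eq_centralizer_endAlg H ⟨ψ⟩,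
    centralizer_coe_adjoin_eq₅₄', Subalgebra.mem_centralizer_iff]
  constructor
  · rintro h _ ⟨g, hg, rfl⟩
    have hgγ := congrArg (fun ε : ψ.lefschetzGroup => ((ε : V ≃ₗ[ℚ] V) : Module.End ℚ V))
      (h ⟨g, ψ.hodgeGroup_le_lefschetzGroup hg⟩)
    simpa only [Subgroup.coe_mul, LinearEquiv.coe_toLinearMap_mul] using hgγ
  · intro h δ
    refine Subtype.ext (LinearEquiv.toLinearMap_injective ?_)
    rw [Subgroup.coe_mul, Subgroup.coe_mul, LinearEquiv.coe_toLinearMap_mul, LinearEquiv.coe_toLinearMap_mul]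
    -- `↑δ ∈ C(H)` and `↑γ ∈ Z(C(H)) = E_φ`
    have hδC : ((δ : V ≃ₗ[ℚ] V) : Module.End ℚ V) ∈ Subalgebra.centralizer ℚ (H.endAlg : Set (Module.End ℚ V)) :=
      (forall_endAlg_apply_iff_coe_mem_centralizer_endAlg H (δ : V ≃ₗ[ℚ] V)).1 ((ψ.mem_lefschetzGroup_iff _).1 δ.2).1
    have hγ' : ((γ : V ≃ₗ[ℚ] V) : Module.End ℚ V) ∈ Subalgebra.centralizer ℚ
        ((Subalgebra.centralizer ℚ (H.endAlg : Set (Module.End ℚ V))) : Set (Module.End ℚ V)) := by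
      rw [← adjoin_hodgeGroup_eq_centralizer_endAlg H ⟨ψ⟩, centralizer_coe_adjoin_eq₅₄']
      exact (Subalgebra.mem_centralizer_iff ℚ).2 h
    exact (Subalgebra.mem_centralizer_iff ℚ).1 hγ' _ hδC

/-- **`Z(S(H)(ℚ)) = S(H)(ℚ) ∩ Z(E_φ)`**: `γ` is central in `S(H)(ℚ)` iff `↑γ = ↑z` for a central Hodge endomorphism `z ∈ Z(E_φ)`
(`S(H)(ℚ) ⊆ C(H)` and `E_φ ∩ C(H) = Z(E_φ)`: the tree's `mem_center_endAlg_iff_coe_mem_centralizer_endAlg`) — the unitary central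
endomorphisms, Milne's `S₀(A)(ℚ) = {γ ∈ C₀(A) | γ†γ = 1}`. [cite: Milne1999LefschetzClasses, §1 p. 644 L16–L24 and p. 645 L1–L6] -/
theorem Polarization.mem_center_lefschetzGroup_iff_exists_mem_center (ψ : Polarization H) (γ : ψ.lefschetzGroup) :
    γ ∈ Subgroup.center ψ.lefschetzGroup ↔
      ∃ z : H.endAlg, z ∈ Subalgebra.center ℚ H.endAlg ∧ (z : Module.End ℚ V) = ((γ : V ≃ₗ[ℚ] V) : Module.End ℚ V) := by
  rw [ψ.mem_center_lefschetzGroup_iff γ]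
  have hγC : ((γ : V ≃ₗ[ℚ] V) : Module.End ℚ V) ∈ Subalgebra.centralizer ℚ (H.endAlg : Set (Module.End ℚ V)) :=
    (forall_endAlg_apply_iff_coe_mem_centralizer_endAlg H (γ : V ≃ₗ[ℚ] V)).1 ((ψ.mem_lefschetzGroup_iff _).1 γ.2).1
  constructor
  · intro h
    exact ⟨⟨_, h⟩, (mem_center_endAlg_iff_coe_mem_centralizer_endAlg H _).2 hγC, rfl⟩
  · rintro ⟨z, -, hz⟩
    rw [← hz]
    exact z.2

/-- **`S(H)(ℚ)` IS COMMUTATIVE IFF `S(H)(ℚ) ⊆ E_φ`** (every element of the Lefschetz group is a Hodge endomorphism — as for CM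
Hodge structures, where `C(H) ⊆ E_φ`; the tree's `Motives/HodgeStructureLefschetzGroupCM` has the criterion «iff `Lie Hg ⊆ E_φ`»).
[cite: Milne1999LefschetzClasses, §1 p. 644 L16–L24 and p. 645 L1–L6] -/
theorem Polarization.center_lefschetzGroup_eq_top_iff (ψ : Polarization H) :
    Subgroup.center ψ.lefschetzGroup = ⊤ ↔
      ∀ γ : V ≃ₗ[ℚ] V, γ ∈ ψ.lefschetzGroup → (γ : Module.End ℚ V) ∈ H.endAlg := by
  rw [Subgroup.eq_top_iff']
  constructor
  · intro h γ hγ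
    exact (ψ.mem_center_lefschetzGroup_iff ⟨γ, hγ⟩).1 (h ⟨γ, hγ⟩)
  · intro h γ
    exact (ψ.mem_center_lefschetzGroup_iff γ).2 (h γ γ.2)

/-- **FOR `E_φ = ℚ` THE CENTRE OF `S(H)(ℚ) = Sp(V, ψ)` IS `{±1}`** (`V ≠ 0`): a central `γ` lies in `E_φ = ℚ · 1`, so `γ = c · 1`, and
`ψ(γ v, γ w) = c² ψ(v, w)` with `ψ` non-degenerate forces `c² = 1` (Milne's «`a ↦ (a⁻¹, a⁻²)` takes values in `L(A)`»: of the
scalars only `±1` preserve `e_D` itself). [cite: Milne1999LefschetzClasses, §1 p. 644 L18–L20 and §4 p. 659 L31–L34]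
[cite: Lange2023AbelianVarietiesComplex, §7.2.4 Exercise (4)] -/
theorem Polarization.mem_center_lefschetzGroup_iff_of_endAlg_eq_bot [Nontrivial V] (ψ : Polarization H) (hE : H.endAlg = ⊥)
    (γ : ψ.lefschetzGroup) :
    γ ∈ Subgroup.center ψ.lefschetzGroup ↔
      ((γ : V ≃ₗ[ℚ] V) : Module.End ℚ V) = 1 ∨ ((γ : V ≃ₗ[ℚ] V) : Module.End ℚ V) = -1 := by
  rw [ψ.mem_center_lefschetzGroup_iff γ, hE, Algebra.mem_bot, Set.mem_range]
  constructor
  · rintro ⟨c, hc⟩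
    rw [Algebra.algebraMap_eq_smul_one] at hc
    -- `ψ(γ v, γ w) = c² ψ(v, w) = ψ(v, w)` for all `v, w`, and `ψ(v, w) ≠ 0` for some `v, w`
    obtain ⟨v, hv⟩ := exists_ne (0 : V)
    obtain ⟨w, hw⟩ : ∃ w, ψ.form v w ≠ 0 := by
      by_contra hall
      push Not at hall
      exact hv (ψ.nondegenerate.1 v hall)
    have hγv : ∀ x : V, (γ : V ≃ₗ[ℚ] V) x = c • x := fun x => by
      have hx := LinearMap.congr_fun hc x
      rw [LinearMap.smul_apply, Module.End.one_apply, LinearEquiv.coe_coe] at hx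
      exact hx.symm
    have hQ := ((ψ.mem_lefschetzGroup_iff _).1 γ.2).2 v w
    rw [hγv, hγv, LinearMap.map_smul₂, map_smul, smul_eq_mul, smul_eq_mul, ← mul_assoc] at hQ
    have hc2 : c * c = 1 := by
      have h1 : (c * c - 1) * ψ.form v w = 0 := by rw [sub_mul, one_mul, hQ, sub_self]
      rcases mul_eq_zero.1 h1 with h | h
      · exact sub_eq_zero.1 h
      · exact absurd h hw
    rcases mul_self_eq_one_iff.1 hc2 with h | h
    · left
      rw [← hc, h, one_smul]
    · right
      rw [← hc, h, neg_smul, one_smul]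
  · rintro (h | h)
    · exact ⟨1, by rw [h, map_one]⟩
    · exact ⟨-1, by rw [h, map_neg, map_one]⟩

end HodgeStructure

end Literature.AlgebraicGeometry.Motives
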